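import Mathlib
import Summits.PneNP.PneNP.Theorems.ConvexRankGatesConvexGateBlindCertificates

/-!
# PneNP / ConvexRankGates — `ConvexGateBlind`: cone factorisation of the certificate matrix

Helpers (`--supports stmt-PneNP-10680`). The route's intended method for the crux
`ConvexGateBlind` ("the size bound is a nonnegative- or psd-rank bound for the certificate matrix")
rests on the **Yannakakis direction for one CONV gate**: if the SDP-feasibility programme
`x ↦ [∃ Y ⪰ 0 (q × q), ∀ i < p, tr(Aᵢ Y) ≤ bᵢ + ∑ₑ Bᵢₑ [xₑ]]` (`B ≥ 0`) accepts some inputs of a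
finite input type and rejects the others, then — after the free trace normalisation `tr Y ≤ R` of
`ConvexRankGatesConvexGateBlindCertificates.lean` —
* every rejected input `u` carries a Farkas certificate `(y_u ≥ 0, λ_u ≥ 0)`, hence a
  non-negative weighting `w_u = Bᵀ y_u` of the input positions and a threshold
  `θ_u = -(y_u · b + λ_u R)` with `w_u · u < θ_u`, and a PSD matrix
  `H_u = ½((∑ᵢ y_{u,i} Aᵢ + λ_u I) + (∑ᵢ y_{u,i} Aᵢ + λ_u I)ᵀ)`;
* every accepted input `x` carries a PSD witness `Y_x` (`tr Y_x ≤ R`) with row slacks `s_x ≥ 0`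
  and trace slack `t_x = R - tr Y_x ≥ 0`;
* and the generalised slack matrix FACTORISES through the self-dual cone
  `PSD_q × ℝ^p_{≥0} × ℝ_{≥0}`:  `w_u · x - θ_u = tr(H_u Y_x) + ∑ᵢ y_{u,i} s_{x,i} + λ_u t_x (≥ 0)`.
So a CONV gate of description `p + q` computing `f` turns the matrix
`[w_u · x - θ_u]_{x ∈ f⁻¹(1), u ∈ f⁻¹(0)}` of valid monotone threshold certificates into a
psd-factorisation of size `q` plus a non-negative factorisation with `p + 1` terms
(`convGate_certificate_factorisation`); the crux asks for lower bounds on exactly such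
factorisations for `CLIQUE(m, ⌈m^δ⌉)`. [folklore: Yannakakis 1991 (LP case);
Gouveia–Parrilo–Thomas 2013, Thm. 1 (cone lifts); Hrubeš 2020, Thm. 20 (monotone LP separators)]
-/

namespace Summit.PneNP.PneNP.Theorems

open Matrix Finset

/-- The quadratic form of `G` at `v` is the trace of `G · (v vᵀ)`. [folklore] -/
theorem trace_mul_vecMulVec_eq_dotProduct {q : ℕ} (G : Matrix (Fin q) (Fin q) ℝ)
    (v : Fin q → ℝ) : (G * vecMulVec v v).trace = v ⬝ᵥ (G *ᵥ v) := by
  simp only [Matrix.trace, Matrix.diag_apply, Matrix.mul_apply, vecMulVec_apply, dotProduct,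
    mulVec, Finset.mul_sum]
  refine Finset.sum_congr rfl fun i _ => Finset.sum_congr rfl fun j _ => ?_
  ring

/-- For a real PSD (hence symmetric) `Y`, `tr(Gᵀ Y) = tr(G Y)`. [folklore] -/
theorem trace_transpose_mul_of_posSemidef {q : ℕ} (G : Matrix (Fin q) (Fin q) ℝ)
    {Y : Matrix (Fin q) (Fin q) ℝ} (hY : Y.PosSemidef) : (Gᵀ * Y).trace = (G * Y).trace := by
  have hYs : Yᵀ = Y := by
    have h := hY.isHermitian
    rwa [Matrix.IsHermitian, Matrix.conjTranspose_eq_transpose_of_trivial] at h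
  calc (Gᵀ * Y).trace = ((Yᵀ * G)ᵀ).trace := by
        rw [Matrix.transpose_mul, Matrix.transpose_transpose]
    _ = (Yᵀ * G).trace := Matrix.trace_transpose _
    _ = (Y * G).trace := by rw [hYs]
    _ = (G * Y).trace := Matrix.trace_mul_comm _ _

/-- The quadratic forms of `G` and `Gᵀ` agree. [folklore] -/
theorem dotProduct_transpose_mulVec {q : ℕ} (G : Matrix (Fin q) (Fin q) ℝ) (v : Fin q → ℝ) :
    v ⬝ᵥ (Gᵀ *ᵥ v) = v ⬝ᵥ (G *ᵥ v) := by
  rw [Matrix.mulVec_transpose, dotProduct_comm, ← Matrix.dotProduct_mulVec]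

/-- **Symmetrised certificates are PSD.** If `0 ≤ tr(G · Y)` for every PSD `Y`, then the
symmetrisation `½(G + Gᵀ)` is positive semidefinite (test on `Y = v vᵀ`). [folklore] -/
theorem posSemidef_symmetrise_of_trace_nonneg {q : ℕ} (G : Matrix (Fin q) (Fin q) ℝ)
    (hG : ∀ Y : Matrix (Fin q) (Fin q) ℝ, Y.PosSemidef → 0 ≤ (G * Y).trace) :
    ((1 / 2 : ℝ) • (G + Gᵀ)).PosSemidef := by
  refine Matrix.PosSemidef.of_dotProduct_mulVec_nonneg ?_ fun v => ?_
  · -- Hermitian = symmetric over `ℝ`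
    change ((1 / 2 : ℝ) • (G + Gᵀ))ᴴ = (1 / 2 : ℝ) • (G + Gᵀ)
    rw [Matrix.conjTranspose_eq_transpose_of_trivial, Matrix.transpose_smul,
      Matrix.transpose_add, Matrix.transpose_transpose, add_comm]
  · have hpsd : (vecMulVec v v).PosSemidef := by
      simpa using Matrix.posSemidef_vecMulVec_self_star v
    have h := hG (vecMulVec v v) hpsd
    rw [trace_mul_vecMulVec_eq_dotProduct] at h
    have hstar : star v = v := star_trivial v
    rw [hstar, Matrix.smul_mulVec, dotProduct_smul, Matrix.add_mulVec, dotProduct_add,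
      dotProduct_transpose_mulVec, smul_eq_mul]
    linarith

/-- Re-bracketing `∑ₑ (∑ᵢ yᵢ Bᵢₑ) vₑ = ∑ᵢ yᵢ ∑ₑ Bᵢₑ vₑ`. [folklore] -/
theorem sum_sum_mul_mul_comm {ι : Type*} [Fintype ι] {p : ℕ} (y : Fin p → ℝ) (B : Fin p → ι → ℝ)
    (v : ι → ℝ) : ∑ e, (∑ i, y i * B i e) * v e = ∑ i, y i * ∑ e, B i e * v e := by
  simp only [Finset.sum_mul, Finset.mul_sum]
  rw [Finset.sum_comm]
  refine Finset.sum_congr rfl fun i _ => Finset.sum_congr rfl fun e _ => ?_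
  ring

/-- Trace of `(∑ᵢ yᵢ Aᵢ + λ I) · Y` expanded by linearity. [folklore] -/
theorem trace_certificateMatrix_mul {p q : ℕ} (A : Fin p → Matrix (Fin q) (Fin q) ℝ)
    (y : Fin p → ℝ) (lam : ℝ) (Y : Matrix (Fin q) (Fin q) ℝ) :
    ((∑ i, y i • A i + lam • (1 : Matrix (Fin q) (Fin q) ℝ)) * Y).trace =
      ∑ i, y i * (A i * Y).trace + lam * Y.trace := by
  rw [Matrix.add_mul, Matrix.trace_add, Matrix.sum_mul, Matrix.trace_sum, Matrix.smul_mul,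
    Matrix.trace_smul, Matrix.one_mul, smul_eq_mul]
  congr 1
  refine Finset.sum_congr rfl fun i _ => ?_
  rw [Matrix.smul_mul, Matrix.trace_smul, smul_eq_mul]

/-- **Cone factorisation of the certificate matrix of one CONV gate** (Yannakakis direction of the
psd-lift factorisation theorem, in the monotone SDP-feasibility format of route ConvexRankGates).
For CONV data `(A, b, B ≥ 0)` on a finite input type there are a trace bound `R > 0`,
certificates `y_u ≥ 0, λ_u ≥ 0` with PSD `H_u = ½(G_u + G_uᵀ)`, `G_u = ∑ᵢ y_{u,i} Aᵢ + λ_u I`, for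
the rejected inputs `u`, and PSD witnesses `Y_x` with slacks `s_x ≥ 0`, `t_x ≥ 0` for the accepted
inputs `x`, such that the non-negative weightings `w_u = Bᵀ y_u` and thresholds
`θ_u = -(y_u · b + λ_u R)` satisfy `w_u · u < θ_u` for rejected `u` and
`w_u · x - θ_u = tr(H_u Y_x) + ∑ᵢ y_{u,i} s_{x,i} + λ_u t_x` for accepted `x` — a factorisation of
the certificate slack matrix through the cone `PSD_q × ℝ^p_{≥0} × ℝ_{≥0}`.
[folklore: Yannakakis 1991; Gouveia–Parrilo–Thomas 2013, Thm. 1; Hrubeš 2020, Thm. 20] -/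
theorem convGate_certificate_factorisation {ι : Type*} [Fintype ι] {p q : ℕ}
    (A : Fin p → Matrix (Fin q) (Fin q) ℝ) (b : Fin p → ℝ) (B : Fin p → ι → ℝ)
    (hB : ∀ i e, 0 ≤ B i e) :
    ∃ (R : ℝ) (y : (ι → Bool) → Fin p → ℝ) (lam : (ι → Bool) → ℝ) (w : (ι → Bool) → ι → ℝ)
      (θ : (ι → Bool) → ℝ) (H : (ι → Bool) → Matrix (Fin q) (Fin q) ℝ)
      (Y : (ι → Bool) → Matrix (Fin q) (Fin q) ℝ) (s : (ι → Bool) → Fin p → ℝ)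
      (t : (ι → Bool) → ℝ),
      0 < R ∧
      (∀ u e, w u e = ∑ i, y u i * B i e) ∧
      (∀ u, θ u = -(∑ i, y u i * b i + lam u * R)) ∧
      (∀ u, H u = (1 / 2 : ℝ) • ((∑ i, y u i • A i + lam u • (1 : Matrix (Fin q) (Fin q) ℝ)) +
        (∑ i, y u i • A i + lam u • (1 : Matrix (Fin q) (Fin q) ℝ))ᵀ)) ∧
      (∀ u, (¬ ∃ Z : Matrix (Fin q) (Fin q) ℝ, Z.PosSemidef ∧
          ∀ i, (A i * Z).trace ≤ b i + ∑ e, B i e * (if u e then (1 : ℝ) else 0)) →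
        (∀ i, 0 ≤ y u i) ∧ 0 ≤ lam u ∧ (∀ e, 0 ≤ w u e) ∧ (H u).PosSemidef ∧
          ∑ e, w u e * (if u e then (1 : ℝ) else 0) < θ u) ∧
      (∀ x, (∃ Z : Matrix (Fin q) (Fin q) ℝ, Z.PosSemidef ∧
          ∀ i, (A i * Z).trace ≤ b i + ∑ e, B i e * (if x e then (1 : ℝ) else 0)) →
        (Y x).PosSemidef ∧ (Y x).trace ≤ R ∧ (∀ i, 0 ≤ s x i) ∧ 0 ≤ t x ∧
          (∀ i, s x i = b i + ∑ e, B i e * (if x e then (1 : ℝ) else 0) - (A i * Y x).trace) ∧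
          t x = R - (Y x).trace ∧
          ∀ u, ∑ e, w u e * (if x e then (1 : ℝ) else 0) - θ u =
            (H u * Y x).trace + ∑ i, y u i * s x i + lam u * t x) := by
  classical
  -- right-hand sides and the free trace bound
  set rhs : (ι → Bool) → Fin p → ℝ := fun x i => b i + ∑ e, B i e * (if x e then (1 : ℝ) else 0)
    with hrhs
  obtain ⟨R, hR, hRiff⟩ := conv_exists_traceBound A rhs
  -- certificates for the rejected inputs (zero elsewhere)
  have hcert : ∀ u : ι → Bool, ∃ (yu : Fin p → ℝ) (lu : ℝ),
      (¬ ∃ Z : Matrix (Fin q) (Fin q) ℝ, Z.PosSemidef ∧ ∀ i, (A i * Z).trace ≤ rhs u i) →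
        (∀ i, 0 ≤ yu i) ∧ 0 ≤ lu ∧
        (∀ Z : Matrix (Fin q) (Fin q) ℝ, Z.PosSemidef →
          0 ≤ ∑ i, yu i * (A i * Z).trace + lu * Z.trace) ∧
        ∑ i, yu i * rhs u i + lu * R < 0 := by
    intro u
    by_cases hu : ∃ Z : Matrix (Fin q) (Fin q) ℝ, Z.PosSemidef ∧ ∀ i, (A i * Z).trace ≤ rhs u i
    · exact ⟨0, 0, fun h => absurd hu h⟩
    · have hinf : ¬ ∃ Z : Matrix (Fin q) (Fin q) ℝ, Z.PosSemidef ∧ Z.trace ≤ R ∧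
          ∀ i, (A i * Z).trace ≤ rhs u i := fun h => hu ((hRiff u).2 h)
      obtain ⟨yu, lu, hy, hl, hpsd, hneg⟩ := certificate_of_infeasible_traceBounded A (rhs u) hR hinf
      exact ⟨yu, lu, fun _ => ⟨hy, hl, hpsd, hneg⟩⟩
  choose y lam hylam using hcert
  -- witnesses for the accepted inputs (zero elsewhere)
  have hwit : ∀ x : ι → Bool, ∃ Yx : Matrix (Fin q) (Fin q) ℝ,
      (∃ Z : Matrix (Fin q) (Fin q) ℝ, Z.PosSemidef ∧ ∀ i, (A i * Z).trace ≤ rhs x i) →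
        Yx.PosSemidef ∧ Yx.trace ≤ R ∧ ∀ i, (A i * Yx).trace ≤ rhs x i := by
    intro x
    by_cases hx : ∃ Z : Matrix (Fin q) (Fin q) ℝ, Z.PosSemidef ∧ ∀ i, (A i * Z).trace ≤ rhs x i
    · obtain ⟨Yx, hYx, htr, hrows⟩ := (hRiff x).1 hx
      exact ⟨Yx, fun _ => ⟨hYx, htr, hrows⟩⟩
    · exact ⟨0, fun h => absurd h hx⟩
  choose Y hYw using hwit
  -- the derived objects
  set G : (ι → Bool) → Matrix (Fin q) (Fin q) ℝ :=
    fun u => ∑ i, y u i • A i + lam u • (1 : Matrix (Fin q) (Fin q) ℝ) with hG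
  refine ⟨R, y, lam, fun u e => ∑ i, y u i * B i e, fun u => -(∑ i, y u i * b i + lam u * R),
    fun u => (1 / 2 : ℝ) • (G u + (G u)ᵀ), Y, fun x i => rhs x i - (A i * Y x).trace,
    fun x => R - (Y x).trace, hR, fun u e => rfl, fun u => rfl, fun u => rfl, ?_, ?_⟩
  · -- rejected inputs
    intro u hu
    obtain ⟨hy, hl, hpsd, hneg⟩ := hylam u hu
    have hw : ∀ e, 0 ≤ ∑ i, y u i * B i e :=
      fun e => Finset.sum_nonneg fun i _ => mul_nonneg (hy i) (hB i e)
    refine ⟨hy, hl, hw, ?_, ?_⟩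
    · refine posSemidef_symmetrise_of_trace_nonneg (G u) fun Z hZ => ?_
      rw [hG, trace_certificateMatrix_mul]
      exact hpsd Z hZ
    · -- `w_u · u - θ_u = ∑ y_i rhs_i(u) + λ R < 0`
      have hexp : ∑ e, (∑ i, y u i * B i e) * (if u e then (1 : ℝ) else 0) =
          ∑ i, y u i * rhs u i - ∑ i, y u i * b i := by
        rw [sum_sum_mul_mul_comm, eq_sub_iff_add_eq, ← Finset.sum_add_distrib]
        refine Finset.sum_congr rfl fun i _ => ?_
        simp only [hrhs]
        ring
      rw [hexp]
      linarith
  · -- accepted inputs and the factorisation identity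
    intro x hx
    obtain ⟨hYx, htr, hrows⟩ := hYw x hx
    refine ⟨hYx, htr, fun i => sub_nonneg.2 (hrows i), sub_nonneg.2 htr, fun i => rfl, rfl,
      fun u => ?_⟩
    have htrH : ((1 / 2 : ℝ) • (G u + (G u)ᵀ) * Y x).trace = (G u * Y x).trace := by
      rw [Matrix.smul_mul, Matrix.trace_smul, Matrix.add_mul, Matrix.trace_add,
        trace_transpose_mul_of_posSemidef (G u) hYx, smul_eq_mul]
      ring
    rw [htrH, hG, trace_certificateMatrix_mul]
    have hexp : ∑ e, (∑ i, y u i * B i e) * (if x e then (1 : ℝ) else 0) =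
        ∑ i, y u i * rhs x i - ∑ i, y u i * b i := by
      rw [sum_sum_mul_mul_comm, eq_sub_iff_add_eq, ← Finset.sum_add_distrib]
      refine Finset.sum_congr rfl fun i _ => ?_
      simp only [hrhs]
      ring
    rw [hexp]
    have hs : ∑ i, y u i * (rhs x i - (A i * Y x).trace) =
        ∑ i, y u i * rhs x i - ∑ i, y u i * (A i * Y x).trace := by
      rw [← Finset.sum_sub_distrib]
      refine Finset.sum_congr rfl fun i _ => ?_
      ring
    rw [hs]
    ring

end Summit.PneNP.PneNP.Theorems
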